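import Summits.QuantumFields.YangMills.Theorems.BalabanUVNodesN11NoExpansionAllLargeCoP
import Literature.MathematicalPhysics.QuantumFieldTheory.Balaban1983to89.Node00.Record12LocalLawsTwoScale

/-!
# DAG node N11 — THE NO-EXPANSION DIAGONAL AT AN ARBITRARY RESIDUAL `Z`: the level-one and the all-large-field level-(k+1) (S1ᵀ) clauses under the
# generation-wise pins, stated ONCE for 12a″'s weights `tkWeightsOfRecordP … (gOfRecord₁₃ θ p) Z` over a FREE residual 𝐓-weight datum `Z` on the torus of
# the run — the common source of the v1.5 `CoP` instances (`Z := θ.Zt K`, landed) and the v1.6 `CoPR` instances (`Z := θ.Zr p`, node00-def-T FILE 25)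

Cell `pub-ymgap`, YM-PLAN Track A (HUMAN RULING D-0062), seat `pub-ymgap-dag-n11-d` (g7; R134 fan-out seat N11 [B14], strategy s2), route `BalabanUVNodes`
rev 21∕22, item K1⁵ `StabilityBAtRecordR13SepCoP` = stmt-QuantumFields-20294 (helper, count-neutral; ports to K1⁶ by token).  [III] = [Balaban1988Convergent].
Over this seat's `…NoExpansionZetaSpec` (p522000, generic level one), `…ZetaSpecSucc` (p527502, generic level k+1), `…TkBranchLinearLocal` (p527289, (L)+(SL)),
`…NoExpansionAllLargeCoP` (p528220, the `CoP` instance whose §1–§2 — history, operands — are residual-free and are CITED here), 12a″ `Node00/TkWeightsOfRecordP`.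

WHY THIS FILE (director-ym №169 H1; dag-lead ORPHAN rule «each pen ports its own files to ⁶ by token»).  FINDING №8 (run-blind `Zt`) is cured in the tree by
node00-def-T's v1.6 record `Stage13RParams` (FILE 25 `Node00/Record13CoPR`, p529474): the 𝐓-weights of the run become `WtOfRecord₁₃R θ p :=
tkWeightsOfRecordP … (gOfRecord₁₃ θ.toStage13Params p) (θ.Zr p)` over a RUN-INDEXED residual `θ.Zr p`, where v1.5 had `WtOfRecord₁₃P θ p := tkWeightsOfRecordP …
(θ.Zt p.K)`.  Both are 12a″'s weights over SOME residual datum `Z : TkResidualW … p.K`; every theorem of this seat's diagonal that read the residual read it only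
through `Z.ζ0`, `Z.quad`, 12b's locality law and the generation-wise pin.  So instead of token twins this file proves the two ★ theorems ONCE with `Z` free:
the `CoP` theorems of p523822 §1 ∕ p528220 §4 are the instances `Z := θ.Zt p.K` (definitionally), the `CoPR` theorems the instances `Z := θ.Zr p` at
`θ.toStage13Params` (sequel file `…NoExpansionDiagonalCoPR`), and node00-def-K0a's residual of record `ZrOfRecord₁₃ θ p` (FILE 17, p529638) — whose pin faces
are exactly the hypotheses `hZ` ∕ `hq` below — discharges the pins there.

WHAT THIS FILE PROVES (0 `sorry`, 0 `def`, standard axioms; `N`-generic; every `θ : Stage13Params`, run `p`, residual `Z`).  §1 faces of 12a″'s weights over `Z`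
(`tkWeightsOfRecordP_ζ_zero_univ` · `_w_zero_empty` · `_ζ_local` (12b's law ⇒ `k`-local for `j ≤ k`) · `_w_empty_eq_one` (`quad_j(∅) = 0`)).  §2 ★ LEVEL ONE
`slotsT_one_ae_eq_sect2Slot_atZ_of_zeta0_pin` (+ clause form): at `Ω₁(s′) = ∅`, under the generation-0 pin `Z.ζ0 0 T (U,V₁) = w(s′)(U,Ū)`, `Z.quad 0 ∅ = 0` there,
unity of def-T's `ζ`, `0 < K`, `1 ≤ M` and the displayed joint measurability of `w(s′)`: `slotT_1(s′) = 𝐓_1(s′)e^{A_1(s′)}` `dV₁`-a.e. at the weights over `Z` and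
def-R's support-edition background, `E_1(s′) = E(p)`, every term-value witness.  §3 ★ «old factors agree» `oldFactors_agree_atZ_of_allLarge` and ★★ LEVEL k+1
`hasSect2FormAtZ_clause_succ_atZ_of_allLarge_pin`: along the all-large-field history, from the §2 form of `ρ_k` at the weights over `Z` (hypothesis `hS`, the
content of `SLaw₁₃CoP`∕`SLaw₁₃CoPR` by their `_iff`), 12b's locality law of `Z`, `quad_j(∅) = 0`, the generation-`k` pin and the displayed measurability ∕ bound of
the old branch: the dichotomy clause of `HasSect2FormTAEZ` at `s′` with `E_{k+1}(s′) = E_k(init s′)`.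

HONEST FRAMING.  The proofs are p523822's and p528220's VERBATIM with `θ.Zt p.K ↦ Z` (kernel bookkeeping; the generic theorems cited do the work); nothing of
Bałaban's asserted; the pins stay HYPOTHESES here (discharged at `ZrOfRecord₁₃` in the sequel); the displayed measurability∕bound hypotheses stay displayed.
N11 NOT discharged; counts unmoved (typed 28∕28 · discharged 5∕28).  One finite four-torus programme at fixed `ε = L^{−K}`; NOT ℝ⁴, NOT OS, NOT a mass gap,
NOT Clay.  Sources: [III] Theorem p.245, (1.11) p.248, (2.18) p.257, (2.20)–(2.23) p.258, (3.2)–(3.5) pp.264–265, (3.16)–(3.21) pp.268–269, (3.24)–(3.25) p.270.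
-/

noncomputable section

open MeasureTheory
open scoped BigOperators Matrix.Norms.L2Operator

namespace Summit.QuantumFields.YangMills.Theorems.BalabanUVNodesN11NoExpansionDiagonalAtZ

open Literature.MathematicalPhysics.QuantumFieldTheory.Balaban1983to89 T4Continuum Node00 Node00.Tk DagBinding
open B15DeterminingSets
open BalabanUVNodesN11NoExpansionZetaSpec (slotsT_one_ae_eq_sect2Slot_of_zeta0_pin)
open BalabanUVNodesN11NoExpansionZetaSpecAtCoP (UbgOfRecord₁₃CoP_one_pairCfg_of_Omega_empty)
open BalabanUVNodesN11TkBranchLinearLocal (tkBranchOfRecord_const_mul tkBranchOfRecord_pairCfgAt_eq_baseCfg)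
open BalabanUVNodesN11NoExpansionZetaSpecSucc (slotsT_succ_ae_eq_sect2Slot_of_zetaSpecAt noExpIntegrandAt_eq_zetaFactor_mul)
open BalabanUVNodesN11NoExpansionAllLargeCoP (init_allLarge admSOfRecord_init_eq_of_allLarge sect2Operand_succ_eq_const_mul_of_allLarge
  sect2Operand_local_of_allLarge)

variable {F : T4Family} {N : ℕ} [NeZero N]

/-! ## §1. Faces of 12a″'s weights over an arbitrary residual `Z` -/

section Faces

variable {ν : Stage7Numerics} {A₁ : ℝ} {p : B12.RunParams} {g : ℕ → ℝ} {Z : TkResidualW F N (FluctV N) p.K}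

/-- The `ζ`-field of 12a″'s weights over `Z` IS `Z.ζ0` (print's `ζ`, no regularity factor; `rfl`). [cite: Balaban1988Convergent, (1.11) p.248, (2.21) p.258] -/
theorem tkWeightsOfRecordP_ζ_apply (j : ℕ) (Y : Set (Site (F.P p.K) 0)) (ω : MultiCfg (F.P p.K) (SU N) (FluctV N)) :
    (tkWeightsOfRecordP F N (FluctV N) ν A₁ p g Z).ζ j Y ω = Z.ζ0 j Y ω := rfl

/-- The empty-region A-weight of 12a″'s weights over `Z` is the Gaussian placeholder `e^{−½ quad_j(∅)}` (`χ(∅, ∅) = 1`). [cite: Balaban1988Convergent, (2.21)–(2.22) p.258, (3.21) p.269] -/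
theorem tkWeightsOfRecordP_w_empty (j : ℕ) (ω : MultiCfg (F.P p.K) (SU N) (FluctV N)) :
    (tkWeightsOfRecordP F N (FluctV N) ν A₁ p g Z).w j ∅ ∅ ∅ ω = Real.exp (-(1 / 2 : ℝ) * Z.quad j ∅ ω) := by
  show chiAW F N (FluctV N) ν A₁ p g j ∅ ∅ ω * Real.exp (-(1 / 2 : ℝ) * Z.quad j ∅ ω) = _
  rw [chiAW_empty_empty, one_mul]

/-- Under 12b's locality law (two-scale since W2∕T1′ 2026-08-29: `ζ0 j` reads scales `j` and `(j+1).1`, [III] (3.1)–(3.4)) the `ζ`-field of 12a″'s weights over `Z` at generation `j` is `k`-local for `j < k` (the `j = k` case is not a theorem under the two-scale row).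
[cite: Balaban1988Convergent, (3.2)–(3.3) p.265, p.267, (1.11) p.248] -/
theorem tkWeightsOfRecordP_ζ_local (hloc : Z.LocalLaws) {k j : ℕ} (hj : j < k) (Y : Set (Site (F.P p.K) 0))
    (ω ω' : MultiCfg (F.P p.K) (SU N) (FluctV N)) (h : ∀ i, i ≤ k → ω i = ω' i) :
    (tkWeightsOfRecordP F N (FluctV N) ν A₁ p g Z).ζ j Y ω = (tkWeightsOfRecordP F N (FluctV N) ν A₁ p g Z).ζ j Y ω' :=
  -- W2∕T2′ of the FLAG №1 R2b cure: restated at `j < k` (the `j = k` case is not a theorem under print's two-scale row); proved through the funnel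
  hloc.localLaws₂.zeta0_local_lt hj Y ω ω' h

/-- With the Gaussian placeholders `quad_j(∅) = 0` the empty-region A-weight of 12a″'s weights over `Z` is `1`. [cite: Balaban1988Convergent, (2.21)–(2.22) p.258, (3.21) p.269] -/
theorem tkWeightsOfRecordP_w_empty_eq_one (hq : ∀ (j : ℕ) (ω : MultiCfg (F.P p.K) (SU N) (FluctV N)), Z.quad j ∅ ω = 0) (j : ℕ)
    (ω : MultiCfg (F.P p.K) (SU N) (FluctV N)) : (tkWeightsOfRecordP F N (FluctV N) ν A₁ p g Z).w j ∅ ∅ ∅ ω = 1 := by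
  rw [tkWeightsOfRecordP_w_empty, hq, mul_zero, Real.exp_zero]

end Faces

/-! ## §2. ★ Level one at an arbitrary residual: the first (S1ᵀ) identity under the generation-0 pin -/

section LevelOne

variable (θ : Stage13Params F N) (p : B12.RunParams) (Z : TkResidualW F N (FluctV N) p.K)

/-- **★ THE FIRST (S1ᵀ)₁₃ IDENTITY AT 12a″'s WEIGHTS OVER AN ARBITRARY RESIDUAL `Z`, UNDER THE GENERATION-0 PIN.**  At the all-large-field new sequence `s′`
(`Ω₁(s′) = ∅`) and def-R's support-edition background `UbgOfRecord₁₃CoP θ p 1`: if `Z.ζ0 0 T (U, V₁) = w(s′)(U, Ū)` and `Z.quad 0 ∅ (U, V₁) = 0`, then for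
EVERY term-value witness `t` the (3.25) identity `slotT_1(s′)(V₁) = 𝐓_1(s′)e^{A_1(s′)}(V₁)` holds `dV₁`-a.e. at the weights `tkWeightsOfRecordP … Z`, with
`E_1(s′) = E(p)` (hypotheses: unity of def-T's `ζ`, the displayed joint measurability of `w(s′)`, `0 < K`, `1 ≤ M`).  p523822's `…_CoP_…` is `Z := θ.Zt K`.
[cite: Balaban1988Convergent, Theorem p.245, (3.25) p.270, (1.11) p.248, (2.18) p.257, (2.21)–(2.23) p.258] -/
theorem slotsT_one_ae_eq_sect2Slot_atZ_of_zeta0_pin (hK : 0 < p.K) (hM : 1 ≤ θ.τ9.M) (hζu : IsZetaUnity F N θ.ν θ.τ9.M θ.ζ)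
    (s : SeqOfRecord F θ.ν θ.τ9.M (gOfRecord₁₃ F N θ p) p.K 1) (hΩ : s.Ω 1 = ∅)
    (t : Sect2.TermValues (F.P p.K) (MatA N) (FluctV N) θ.τ9.M)
    (hZ : ∀ (V1 : GaugeField (F.P p.K) 1 (SU N)) (Uf : GaugeField (F.P p.K) 0 (SU N)),
      Z.ζ0 0 Set.univ (pairCfg (V := FluctV N) V1 Uf) =
        wOfRecord₉ F N θ.toStage9Params p (gOfRecord₁₃ F N θ p) 0 s Uf ((avOfRecord F N p.K 0).avg Uf))
    (hq : ∀ (V1 : GaugeField (F.P p.K) 1 (SU N)) (Uf : GaugeField (F.P p.K) 0 (SU N)), Z.quad 0 ∅ (pairCfg (V := FluctV N) V1 Uf) = 0)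
    (hmw : Measurable fun z : GaugeField (F.P p.K) 1 (SU N) × GaugeField (F.P p.K) 0 (SU N) =>
      wOfRecord₉ F N θ.toStage9Params p (gOfRecord₁₃ F N θ p) 0 s z.2 z.1) :
    ∀ᵐ V1 ∂fieldMeasure (F.P p.K) 1 (SU N),
      chiSeqOfRecord F N θ.ν θ.τ9.M (gOfRecord₁₃ F N θ p) p.K 1 s V1 ≠ 0 →
        slotsTOfRecord F N θ.ν θ.τ9 (EOfRecord₁₃ F N θ) (wOfRecord₉ F N θ.toStage9Params) θ.ppSel p
            (gOfRecord₁₃ F N θ p) 1 s V1 =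
          sect2Slot F N (FluctV N) p.K (settingOfRecord₁₃ F N θ p) (θ.Rz p.K)
            (tkWeightsOfRecordP F N (FluctV N) θ.ν θ.A₁ p (gOfRecord₁₃ F N θ p) Z) s t (EOfRecord₁₃ F N θ p)
            (UbgOfRecord₁₃CoP F N θ p 1 s) V1 :=
  slotsT_one_ae_eq_sect2Slot_of_zeta0_pin θ p hK hM hζu s hΩ (tkWeightsOfRecordP F N (FluctV N) θ.ν θ.A₁ p (gOfRecord₁₃ F N θ p) Z) t
    (UbgOfRecord₁₃CoP F N θ p 1 s) (UbgOfRecord₁₃CoP_one_pairCfg_of_Omega_empty θ p s hΩ) Z (fun _ => rfl)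
    (fun ω => tkWeightsOfRecordP_w_empty 0 ω) hZ hq hmw

/-- **… HENCE THE DICHOTOMY CLAUSE OF `HasSect2FormAtZ` AT `s′`** at the weights over `Z` (identity branch, witness `(t, E(p))`).
[cite: Balaban1988Convergent, (2.17)–(2.18) p.257, (3.25) p.270, remark p.262] -/
theorem hasSect2FormAtZ_clause_one_atZ_of_zeta0_pin (hK : 0 < p.K) (hM : 1 ≤ θ.τ9.M) (hζu : IsZetaUnity F N θ.ν θ.τ9.M θ.ζ)
    (s : SeqOfRecord F θ.ν θ.τ9.M (gOfRecord₁₃ F N θ p) p.K 1) (hΩ : s.Ω 1 = ∅)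
    (t : Sect2.TermValues (F.P p.K) (MatA N) (FluctV N) θ.τ9.M)
    (hZ : ∀ (V1 : GaugeField (F.P p.K) 1 (SU N)) (Uf : GaugeField (F.P p.K) 0 (SU N)),
      Z.ζ0 0 Set.univ (pairCfg (V := FluctV N) V1 Uf) =
        wOfRecord₉ F N θ.toStage9Params p (gOfRecord₁₃ F N θ p) 0 s Uf ((avOfRecord F N p.K 0).avg Uf))
    (hq : ∀ (V1 : GaugeField (F.P p.K) 1 (SU N)) (Uf : GaugeField (F.P p.K) 0 (SU N)), Z.quad 0 ∅ (pairCfg (V := FluctV N) V1 Uf) = 0)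
    (hmw : Measurable fun z : GaugeField (F.P p.K) 1 (SU N) × GaugeField (F.P p.K) 0 (SU N) =>
      wOfRecord₉ F N θ.toStage9Params p (gOfRecord₁₃ F N θ p) 0 s z.2 z.1) :
    slotsTOfRecord F N θ.ν θ.τ9 (EOfRecord₁₃ F N θ) (wOfRecord₉ F N θ.toStage9Params) θ.ppSel p (gOfRecord₁₃ F N θ p) 1 s = 0 ∨
      ∀ᵐ V1 ∂fieldMeasure (F.P p.K) 1 (SU N),
        chiSeqOfRecord F N θ.ν θ.τ9.M (gOfRecord₁₃ F N θ p) p.K 1 s V1 ≠ 0 →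
          slotsTOfRecord F N θ.ν θ.τ9 (EOfRecord₁₃ F N θ) (wOfRecord₉ F N θ.toStage9Params) θ.ppSel p
              (gOfRecord₁₃ F N θ p) 1 s V1 =
            sect2Slot F N (FluctV N) p.K (settingOfRecord₁₃ F N θ p) (θ.Rz p.K)
              (tkWeightsOfRecordP F N (FluctV N) θ.ν θ.A₁ p (gOfRecord₁₃ F N θ p) Z) s t (EOfRecord₁₃ F N θ p)
              (UbgOfRecord₁₃CoP F N θ p 1 s) V1 :=
  Or.inr (slotsT_one_ae_eq_sect2Slot_atZ_of_zeta0_pin θ p Z hK hM hζu s hΩ t hZ hq hmw)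

end LevelOne

/-! ## §3. ★★ Level k+1 along the all-large-field history at an arbitrary residual: «old factors agree» and the (S1ᵀ) clause under the generation-k pin -/

section LevelSucc

variable (θ : Stage13Params F N) (p : B12.RunParams) (Z : TkResidualW F N (FluctV N) p.K)

/-- **★ «THE OLD FACTORS AGREE» AT THE WEIGHTS OVER `Z` ALONG THE ALL-LARGE-FIELD HISTORY** ((3.24)): for the all-empty old branch, the old branch operator of
the new operand at the two-scale configuration equals `e^{E_k − E_{k+1}}` times the old branch operator of the old operand at the base configuration —
linearity (L) for the constant, scale-locality (SL) for the configuration (12b's locality law of `Z`; `quad_j(∅) = 0`; the operands read scale `0`), `M ≥ 1`.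
p528220's `…_CoP_…` is `Z := θ.Zt K`. [cite: Balaban1988Convergent, (3.24) p.270, (2.20)–(2.23) p.258] -/
theorem oldFactors_agree_atZ_of_allLarge (hM : 1 ≤ θ.τ9.M) (hloc : Z.LocalLaws)
    (hq : ∀ (j : ℕ) (ω : MultiCfg (F.P p.K) (SU N) (FluctV N)), Z.quad j ∅ ω = 0)
    {k : ℕ} (s : SeqOfRecord F θ.ν θ.τ9.M (gOfRecord₁₃ F N θ p) p.K (k + 1)) (hall : ∀ j, 1 ≤ j → j ≤ k + 1 → s.Ω j = ∅)
    (t t' : Sect2.TermValues (F.P p.K) (MatA N) (FluctV N) θ.τ9.M) (Ek Ek' : ℝ)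
    (V' : GaugeField (F.P p.K) (k + 1) (SU N)) (U₀ : GaugeField (F.P p.K) k (SU N)) :
    tkBranchOfRecord F N (FluctV N) θ.ν θ.τ9.M _ p.K (tkWeightsOfRecordP F N (FluctV N) θ.ν θ.A₁ p (gOfRecord₁₃ F N θ p) Z) s.init (fun _ => ∅) k
        (fun ω => sect2Operand F N (FluctV N) p.K (settingOfRecord₁₃ F N θ p) (θ.Rz p.K) s t' Ek' (UbgOfRecord₁₃CoP F N θ p (k + 1) s)
          ((fun _ => ∅ : ℕ → Set (Site (F.P p.K) 0)), fun j => (ω j).2) (fun j => (ω j).1))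
        (pairCfgAt (V := FluctV N) k V' U₀) =
      Real.exp (Ek - Ek') * tkBranchOfRecord F N (FluctV N) θ.ν θ.τ9.M _ p.K (tkWeightsOfRecordP F N (FluctV N) θ.ν θ.A₁ p (gOfRecord₁₃ F N θ p) Z) s.init (fun _ => ∅) k
        (fun ω => sect2Operand F N (FluctV N) p.K (settingOfRecord₁₃ F N θ p) (θ.Rz p.K) s.init t Ek (UbgOfRecord₁₃CoP F N θ p k s.init)
          ((fun _ => ∅ : ℕ → Set (Site (F.P p.K) 0)), fun j => (ω j).2) (fun j => (ω j).1))
        (baseCfg (V := FluctV N) k U₀) := by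
  have hinit := init_allLarge θ p s hall
  rw [sect2Operand_succ_eq_const_mul_of_allLarge θ p hM s hall t t' Ek Ek' (fun _ => ∅) (fun _ => ∅), tkBranchOfRecord_const_mul]
  congr 1
  refine tkBranchOfRecord_pairCfgAt_eq_baseCfg θ.ν θ.τ9.M _ p.K (tkWeightsOfRecordP F N (FluctV N) θ.ν θ.A₁ p (gOfRecord₁₃ F N θ p) Z) s.init (fun _ => ∅) ?_ ?_ ?_ V' U₀
  · intro j hj ω ω' h
    exact hloc.localLaws₂.zeta0_local_lt hj _ ω ω' h  -- v1.1 (T0′ of the FLAG №1 R2b cure): through the funnel, not the `j ≤ k` lemma above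
  · intro j hj ω ω' _
    have hΩ : s.init.Ω (j + 1) = ∅ := hinit (j + 1) (by omega) (by omega)
    have hΛ : s.init.Λ (j + 1) = ∅ := seq_Λ_eq_empty_of_Ω_eq_empty s.init hΩ
    rw [hΛ, hΩ, Set.inter_empty, tkWeightsOfRecordP_w_empty_eq_one hq, tkWeightsOfRecordP_w_empty_eq_one hq]
  · intro ω ω' h
    exact sect2Operand_local_of_allLarge θ p hM s.init hinit t Ek (fun _ => ∅) ω ω' h

/-- **★★ THE NO-EXPANSION DIAGONAL IS REACHABLE UNDER GENERATION-WISE PINS, AT THE WEIGHTS OVER AN ARBITRARY RESIDUAL `Z`.**  Let `s′` be the all-large-field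
new sequence of length `k+1` (`Ω_j(s′) = ∅` for every `1 ≤ j ≤ k+1`; `k < K`, `1 ≤ M`), and suppose the post-𝐑 slot family of record has the §2 form at level
`k` at the weights `tkWeightsOfRecordP … Z` and def-R's support-edition background (`hS` — the content of `SLaw₁₃CoP θ p k` at `Z := θ.Zt K`, of
`SLaw₁₃CoPR θ p k` at `Z := θ.Zr p`).  Suppose `Z` obeys 12b's locality law, has `quad_j(∅) = 0`, and is PINNED at generation `k` on `T` by def-T's level-`k`
resummed step weight on the scale-`k` averaging graph, `Z.ζ0 k T (V_k, V_{k+1}) = w_k(s′)(V_k, V̄_k)`.  Then, under unity of def-T's `ζ` and the displayed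
measurability ∕ bound of the old branch and joint measurability of `w_k(s′)`, the dichotomy clause of `HasSect2FormTAEZ … k (UbgOfRecord₁₃CoP θ p (k+1)) slotT`
AT `s′` holds for EVERY term-value witness `t′`, with `E_{k+1}(s′) := E_k(init s′)` of `hS`'s witness.  p528220's `…_CoP_…` is `Z := θ.Zt K`.
[cite: Balaban1988Convergent, Theorem p.245, (3.24)–(3.25) p.270, (2.18) p.257, (2.20)–(2.23) p.258, (3.16) p.268, (1.11) p.248] -/
theorem hasSect2FormAtZ_clause_succ_atZ_of_allLarge_pin {k : ℕ} (hk : k < p.K) (hM : 1 ≤ θ.τ9.M) (hζu : IsZetaUnity F N θ.ν θ.τ9.M θ.ζ)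
    (hloc : Z.LocalLaws) (hq : ∀ (j : ℕ) (ω : MultiCfg (F.P p.K) (SU N) (FluctV N)), Z.quad j ∅ ω = 0)
    (hS : HasSect2FormAEZ F N (FluctV N) p.K (settingOfRecord₁₃ F N θ p) (θ.Rz p.K) (tkWeightsOfRecordP F N (FluctV N) θ.ν θ.A₁ p (gOfRecord₁₃ F N θ p) Z) k
      (UbgOfRecord₁₃CoP F N θ p k)
      (slotsOfRecord F N θ.ν θ.τ9 (EOfRecord₁₃ F N θ) (wOfRecord₉ F N θ.toStage9Params) θ.ppSel p (gOfRecord₁₃ F N θ p) k))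
    (s : SeqOfRecord F θ.ν θ.τ9.M (gOfRecord₁₃ F N θ p) p.K (k + 1)) (hall : ∀ j, 1 ≤ j → j ≤ k + 1 → s.Ω j = ∅)
    (hZ : ∀ (V' : GaugeField (F.P p.K) (k + 1) (SU N)) (U₀ : GaugeField (F.P p.K) k (SU N)),
      Z.ζ0 k Set.univ (pairCfgAt (V := FluctV N) k V' U₀) =
        wOfRecord₉ F N θ.toStage9Params p (gOfRecord₁₃ F N θ p) k s U₀ ((avOfRecord F N p.K k).avg U₀))
    (hmw : Measurable fun z : GaugeField (F.P p.K) (k + 1) (SU N) × GaugeField (F.P p.K) k (SU N) =>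
      wOfRecord₉ F N θ.toStage9Params p (gOfRecord₁₃ F N θ p) k s z.2 z.1)
    {C : ℝ}
    (hmB : ∀ (t : Sect2.TermValues (F.P p.K) (MatA N) (FluctV N) θ.τ9.M) (Ek : ℝ),
      Measurable fun U₀ : GaugeField (F.P p.K) k (SU N) =>
        tkBranchOfRecord F N (FluctV N) θ.ν θ.τ9.M _ p.K (tkWeightsOfRecordP F N (FluctV N) θ.ν θ.A₁ p (gOfRecord₁₃ F N θ p) Z) s.init (fun _ => ∅) k
          (fun ω => sect2Operand F N (FluctV N) p.K (settingOfRecord₁₃ F N θ p) (θ.Rz p.K) s.init t Ek (UbgOfRecord₁₃CoP F N θ p k s.init)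
            ((fun _ => ∅ : ℕ → Set (Site (F.P p.K) 0)), fun j => (ω j).2) (fun j => (ω j).1))
          (baseCfg (V := FluctV N) k U₀))
    (hCB : ∀ (t : Sect2.TermValues (F.P p.K) (MatA N) (FluctV N) θ.τ9.M) (Ek : ℝ) (U₀ : GaugeField (F.P p.K) k (SU N)),
      |tkBranchOfRecord F N (FluctV N) θ.ν θ.τ9.M _ p.K (tkWeightsOfRecordP F N (FluctV N) θ.ν θ.A₁ p (gOfRecord₁₃ F N θ p) Z) s.init (fun _ => ∅) k
          (fun ω => sect2Operand F N (FluctV N) p.K (settingOfRecord₁₃ F N θ p) (θ.Rz p.K) s.init t Ek (UbgOfRecord₁₃CoP F N θ p k s.init)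
            ((fun _ => ∅ : ℕ → Set (Site (F.P p.K) 0)), fun j => (ω j).2) (fun j => (ω j).1))
          (baseCfg (V := FluctV N) k U₀)| ≤ C)
    (t' : Sect2.TermValues (F.P p.K) (MatA N) (FluctV N) θ.τ9.M) :
    ∃ Ek' : ℝ,
      slotsTOfRecord F N θ.ν θ.τ9 (EOfRecord₁₃ F N θ) (wOfRecord₉ F N θ.toStage9Params) θ.ppSel p (gOfRecord₁₃ F N θ p) (k + 1) s = 0 ∨
        ∀ᵐ V' ∂fieldMeasure (F.P p.K) (k + 1) (SU N),
          chiSeqOfRecord F N θ.ν θ.τ9.M (gOfRecord₁₃ F N θ p) p.K (k + 1) s V' ≠ 0 →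
            slotsTOfRecord F N θ.ν θ.τ9 (EOfRecord₁₃ F N θ) (wOfRecord₉ F N θ.toStage9Params) θ.ppSel p
                (gOfRecord₁₃ F N θ p) (k + 1) s V' =
              sect2Slot F N (FluctV N) p.K (settingOfRecord₁₃ F N θ p) (θ.Rz p.K) (tkWeightsOfRecordP F N (FluctV N) θ.ν θ.A₁ p (gOfRecord₁₃ F N θ p) Z) s t' Ek'
                (UbgOfRecord₁₃CoP F N θ p (k + 1) s) V' := by
  classical
  obtain ⟨t, Ek, -, hs⟩ := hS
  refine ⟨Ek s.init, ?_⟩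
  have hinit := init_allLarge θ p s hall
  have hΩtop : s.Ω (k + 1) = ∅ := hall (k + 1) (by omega) le_rfl
  -- `χ_k(init s′) ≡ 1`: no front factor along the history
  have hχ : ∀ U₀ : GaugeField (F.P p.K) k (SU N), chiSeqOfRecord F N θ.ν θ.τ9.M (gOfRecord₁₃ F N θ p) p.K k s.init U₀ = 1 := by
    intro U₀
    rcases Nat.eq_zero_or_pos k with hk0 | hkpos
    · subst hk0; exact chiSeqOfRecord_zero F N θ.ν θ.τ9.M _ p.K s.init U₀
    · exact chiSeqOfRecord_eq_one_of_Omega_empty F N θ.ν θ.τ9.M _ p.K k s.init (hinit k hkpos le_rfl) U₀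
  rcases (hs s.init).2 with h0 | hid
  · -- absent slot at `init s′` ⇒ absent pre-𝐑 slot at `s′`
    refine Or.inl ?_
    funext V'
    rw [slotsTOfRecord_succ_apply, h0]
    show transportOfRecord F N p.K k (fun U => _ * (_ * (0 : ℝ))) V' = 0
    simp only [mul_zero]
    show T4AveragingDisintegration.kernelTransport _ _ _ (fun _ => (0 : ℝ)) V' = 0
    simp only [T4AveragingDisintegration.kernelTransport, integral_zero, mul_zero]
  · refine Or.inr ?_
    -- the old index is `{∅}`: every hypothesis per old branch is one statement about the all-empty branch
    have hA := admSOfRecord_init_eq_of_allLarge θ p s hall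
    -- the new integrand of the all-empty branch, closed form: `w_k(s′)(U₀, Ū₀) · e^{E_k − E_{k+1}} · B(U₀)` with `E_{k+1} = E_k`
    have hold := oldFactors_agree_atZ_of_allLarge θ p Z hM hloc hq s hall (t s.init) t' (Ek s.init) (Ek s.init)
    have hfac : ∀ (V' : GaugeField (F.P p.K) (k + 1) (SU N)) (U₀ : GaugeField (F.P p.K) k (SU N)),
        (tkWeightsOfRecordP F N (FluctV N) θ.ν θ.A₁ p (gOfRecord₁₃ F N θ p) Z).ζ k Set.univ (pairCfgAt (V := FluctV N) k V' U₀) * (tkWeightsOfRecordP F N (FluctV N) θ.ν θ.A₁ p (gOfRecord₁₃ F N θ p) Z).w k ∅ ∅ ∅ (pairCfgAt (V := FluctV N) k V' U₀) =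
          wOfRecord₉ F N θ.toStage9Params p (gOfRecord₁₃ F N θ p) k s U₀ ((avOfRecord F N p.K k).avg U₀) := by
      intro V' U₀
      rw [tkWeightsOfRecordP_w_empty_eq_one hq, mul_one]
      exact (hZ V' U₀)
    have hint : ∀ (V' : GaugeField (F.P p.K) (k + 1) (SU N)) (U₀ : GaugeField (F.P p.K) k (SU N)),
        noExpIntegrandAt F N (FluctV N) p.K k (tkWeightsOfRecordP F N (FluctV N) θ.ν θ.A₁ p (gOfRecord₁₃ F N θ p) Z)
            (tkBranchOfRecord F N (FluctV N) θ.ν θ.τ9.M _ p.K (tkWeightsOfRecordP F N (FluctV N) θ.ν θ.A₁ p (gOfRecord₁₃ F N θ p) Z) s.init (fun _ => ∅) k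
              (fun ω => sect2Operand F N (FluctV N) p.K (settingOfRecord₁₃ F N θ p) (θ.Rz p.K) s t' (Ek s.init) (UbgOfRecord₁₃CoP F N θ p (k + 1) s)
                ((fun _ => ∅ : ℕ → Set (Site (F.P p.K) 0)), fun j => (ω j).2) (fun j => (ω j).1)))
            V' U₀ =
          wOfRecord₉ F N θ.toStage9Params p (gOfRecord₁₃ F N θ p) k s U₀ ((avOfRecord F N p.K k).avg U₀) *
            tkBranchOfRecord F N (FluctV N) θ.ν θ.τ9.M _ p.K (tkWeightsOfRecordP F N (FluctV N) θ.ν θ.A₁ p (gOfRecord₁₃ F N θ p) Z) s.init (fun _ => ∅) k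
              (fun ω => sect2Operand F N (FluctV N) p.K (settingOfRecord₁₃ F N θ p) (θ.Rz p.K) s.init (t s.init) (Ek s.init)
                (UbgOfRecord₁₃CoP F N θ p k s.init) ((fun _ => ∅ : ℕ → Set (Site (F.P p.K) 0)), fun j => (ω j).2) (fun j => (ω j).1))
              (baseCfg (V := FluctV N) k U₀) := by
      intro V' U₀
      rw [noExpIntegrandAt_eq_zetaFactor_mul, hfac, hold V' U₀, sub_self, Real.exp_zero, one_mul]
    -- measurability ∕ bound of the new integrand (displayed data on `w_k(s′)` and on the old branch)
    have hw0 : ∀ U₀ : GaugeField (F.P p.K) k (SU N), 0 ≤ wOfRecord₉ F N θ.toStage9Params p (gOfRecord₁₃ F N θ p) k s U₀ ((avOfRecord F N p.K k).avg U₀) :=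
      fun U₀ => wOfRecord_nonneg_of_Omega_empty F N θ.ν θ.τ9.M θ.A₁ p (gOfRecord₁₃ F N θ p) k hζu s hΩtop U₀ _
    have hw1 : ∀ U₀ : GaugeField (F.P p.K) k (SU N), wOfRecord₉ F N θ.toStage9Params p (gOfRecord₁₃ F N θ p) k s U₀ ((avOfRecord F N p.K k).avg U₀) ≤ 1 :=
      fun U₀ => wOfRecord_le_one_of_Omega_empty F N θ.ν θ.τ9.M θ.A₁ p (gOfRecord₁₃ F N θ p) k hζu s hΩtop U₀ _
    have hg : Measurable fun U₀ : GaugeField (F.P p.K) k (SU N) =>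
        ((((avOfRecord F N p.K k).avg U₀), U₀) : GaugeField (F.P p.K) (k + 1) (SU N) × GaugeField (F.P p.K) k (SU N)) :=
      (avOfRecord_measurable F N p.K k).prodMk measurable_id
    have hgraph : Measurable fun U₀ : GaugeField (F.P p.K) k (SU N) =>
        wOfRecord₉ F N θ.toStage9Params p (gOfRecord₁₃ F N θ p) k s U₀ ((avOfRecord F N p.K k).avg U₀) := by
      simpa only [Function.comp_def] using hmw.comp hg
    refine slotsT_succ_ae_eq_sect2Slot_of_zetaSpecAt θ p hk s hΩtop (tkWeightsOfRecordP F N (FluctV N) θ.ν θ.A₁ p (gOfRecord₁₃ F N θ p) Z) (t s.init) (Ek s.init)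
      (UbgOfRecord₁₃CoP F N θ p k s.init) hid hχ t' (Ek s.init) (UbgOfRecord₁₃CoP F N θ p (k + 1) s) (κ := 1) (c := 1) (C := C) (one_mul 1)
      ?_ ?_ ?_ ?_
    · -- old-factor agreement on the old index `{∅}`
      intro S hS V' U₀
      rw [hA, Finset.mem_singleton] at hS
      subst hS
      rw [hold V' U₀, sub_self, Real.exp_zero]
    · -- the generation-`k` spec with `c = 1`
      intro U₀
      rw [hfac, one_mul]
    · -- measurability of the new integrand per old branch
      intro S hS
      rw [hA, Finset.mem_singleton] at hS
      subst hS
      have hfun : Function.uncurry (noExpIntegrandAt F N (FluctV N) p.K k (tkWeightsOfRecordP F N (FluctV N) θ.ν θ.A₁ p (gOfRecord₁₃ F N θ p) Z)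
          (tkBranchOfRecord F N (FluctV N) θ.ν θ.τ9.M _ p.K (tkWeightsOfRecordP F N (FluctV N) θ.ν θ.A₁ p (gOfRecord₁₃ F N θ p) Z) s.init (fun _ => ∅) k
            (fun ω => sect2Operand F N (FluctV N) p.K (settingOfRecord₁₃ F N θ p) (θ.Rz p.K) s t' (Ek s.init) (UbgOfRecord₁₃CoP F N θ p (k + 1) s)
              ((fun _ => ∅ : ℕ → Set (Site (F.P p.K) 0)), fun j => (ω j).2) (fun j => (ω j).1)))) =
          fun z => wOfRecord₉ F N θ.toStage9Params p (gOfRecord₁₃ F N θ p) k s z.2 ((avOfRecord F N p.K k).avg z.2) *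
            tkBranchOfRecord F N (FluctV N) θ.ν θ.τ9.M _ p.K (tkWeightsOfRecordP F N (FluctV N) θ.ν θ.A₁ p (gOfRecord₁₃ F N θ p) Z) s.init (fun _ => ∅) k
              (fun ω => sect2Operand F N (FluctV N) p.K (settingOfRecord₁₃ F N θ p) (θ.Rz p.K) s.init (t s.init) (Ek s.init)
                (UbgOfRecord₁₃CoP F N θ p k s.init) ((fun _ => ∅ : ℕ → Set (Site (F.P p.K) 0)), fun j => (ω j).2) (fun j => (ω j).1))
              (baseCfg (V := FluctV N) k z.2) := by
        funext z
        rcases z with ⟨V', U₀⟩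
        exact hint V' U₀
      rw [hfun]
      exact (hgraph.comp measurable_snd).mul ((hmB (t s.init) (Ek s.init)).comp measurable_snd)
    · -- bound of the new integrand per old branch: `|w·B| ≤ C`
      intro S hS V' U₀
      rw [hA, Finset.mem_singleton] at hS
      subst hS
      rw [hint V' U₀, abs_mul, abs_of_nonneg (hw0 U₀)]
      have hC0 : 0 ≤ C := (abs_nonneg _).trans (hCB (t s.init) (Ek s.init) U₀)
      calc wOfRecord₉ F N θ.toStage9Params p (gOfRecord₁₃ F N θ p) k s U₀ ((avOfRecord F N p.K k).avg U₀) * _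
          ≤ 1 * C := mul_le_mul (hw1 U₀) (hCB (t s.init) (Ek s.init) U₀) (abs_nonneg _) zero_le_one
        _ = C := one_mul C

end LevelSucc

end Summit.QuantumFields.YangMills.Theorems.BalabanUVNodesN11NoExpansionDiagonalAtZ

end
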